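import Summits.BirchSwinnertonDyer.BirchSwinnertonDyer.Theorems.EisensteinPrimesAcTwistDeformationLocalShapiro
import Summits.BirchSwinnertonDyer.BirchSwinnertonDyer.Theorems.EisensteinPrimesUnramifiedLeAwayKer
import Summits.BirchSwinnertonDyer.BirchSwinnertonDyer.Theorems.EisensteinPrimesTwoVariableSelmerControl
import HarnessLib

/-!
# Route `EisensteinPrimes` (rung K5), crux 2 `GoodLatticeBDPValue`, line `halves` v16, stub
# `stub_imprimCorank`, road (A): the LOCAL CLASSES of the Shapiro descent — `res_{D_w} conj_σ F[c]` is the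
# evaluation class `x ↦ ψ(c_w(τ_x)(κ σ))` of the local cocycle `c_w = loc_w c`; the descent with
# prescribed vanishing lands in `H¹_{𝓕_nr^{S₀}}(K_∞, M)`; `H¹_{𝓕_nr}(K_∞, M)` dies in every
# `H¹(ker κ ⊓ D_w, M)`, `w ∈ S_f` (helper for stmt-BirchSwinnertonDyer-19032)

Cell `bsd-eis`, seat `bsd-line-x1-p1` LEAD g2 (D-0154 row 4); seventh file of road (A) (kernel derivation of
`prop125_residualPair_unrSelmer_corank_ge` from Greenberg's `SUR`, [Greenberg2016Selmer] Prop. 2.6.3).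
Files 4–6 gave the Shapiro descent `F : H¹(K_Σ/K, 𝐃₁) → H¹(K_∞, M)` (`exists_shapiroDescent`), its landing
in `H¹_{𝓕_nr}` for Greenberg-Selmer classes, and local Shapiro surjectivity. THIS FILE supplies the three
class-level facts the surjectivity assembly (`≥` half of the `S`-relaxation identity) consumes:

* §1 `loc_bigRep_oneCocycleClass_eq_iff` — `loc_w[c] = [c']` iff `c|_{Γ_{K_w}} − c'` is principal;
* §2 `shapiroDescent_mem_unrSelmer_of_loc_eq_zero` — if `loc_w[c] = 0` at every finite `w ∈ S`, `w ≠ v`,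
  off `S₀` (and at `v̄`), then `F[c] ∈ H¹_{𝓕_nr^{S₀}}(K_∞, M)` (the `S₀`-version of file 5's landing);
* §3 **`resOfLe_conjH1_shapiroDescent_eq`** — for `σ ∈ Γ_K` and a local cocycle `c'` with `loc_w[c] = [c']`:
  `res_{ker κ ⊓ D_w}(conj_σ F[c]) = [x ↦ ψ(c'(τ_x)(κ σ))]` (`τ_x ∈ Γ_{K_w}` over `x`): conjugating by `σ`
  moves the Shapiro evaluation point from `0` to `κ σ` ([SkinnerUrban2014] (3.1.2.a) `φ_w(g) = φ(g g_w)`;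
  bsd-stepL `rho_apply_conj_zero`);
* §4 `resOfLe_conjH1_eq_zero_of_mem_unrSelmer_empty` — classes of `H¹_{𝓕_nr}(K_∞, M)` (`S₀ = ∅`) are
  locally trivial at every place of `K_∞` above a finitely decomposed `w ∤ p`
  (`unramifiedKer_le_awayKer_of_not_decomp_le`).

Theorems only; no named fact, no `sorry`. HONEST FRAMING: closes nothing by itself (`--supports`).
References: [SkinnerUrban2014] §3.1.2–3.1.3, Prop. 3.2.3; [GreenbergVatsal2000] §2 pp. 16–17, 20;
[Greenberg2016Selmer] §1 p. 3; [KellerYin2024] Prop. 1.2.5 (arXiv:2402.12781v2).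
-/

set_option autoImplicit false
set_option linter.dupNamespace false

noncomputable section

open scoped Classical
open NumberField IsDedekindDomain Field Multiplicative PowerSeries
open Literature.NumberTheory.EllipticCurves Literature.NumberTheory.EllipticCurves.GreenbergSelmer
  Literature.NumberTheory.EllipticCurves.GreenbergVatsal2000 Literature.NumberTheory.GaloisRepresentations
  Literature.NumberTheory.EllipticCurves.KellerYin2024 Literature.NumberTheory.EllipticCurves.IwasawaDual
  Literature.NumberTheory.IwasawaTheory Literature.NumberTheory.IwasawaTheory.Greenberg2016
  Literature.NumberTheory.IwasawaTheory.Greenberg2006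
  Summit.BirchSwinnertonDyer.BirchSwinnertonDyer.Theorems.GreenbergFullAtSelmer

namespace Summit.BirchSwinnertonDyer.BirchSwinnertonDyer.Theorems.AcTwistDeformation

section LocalClasses

variable {K : Type} [Field K] [NumberField K] (S : Set (HeightOneSpectrum (𝓞 K))) {p : ℕ} [Fact p.Prime]
  {A : Type} [AddCommGroup A] [Module ℤ_[p] A] [TopologicalSpace A] [DiscreteTopology A]
  [TopologicalSpace (PowerSeries ℤ_[p])] [IsTopologicalRing (PowerSeries ℤ_[p])]
  [IsTopologicalAddGroup (BigRepModule ℤ_[p] p A)] [ContinuousSMul (PowerSeries ℤ_[p]) (BigRepModule ℤ_[p] p A)]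
  (hS : ∀ v : HeightOneSpectrum (𝓞 K), ((p : ℕ) : 𝓞 K) ∈ v.asIdeal → v ∈ S)
  (κ : ZpExtension K p) (ρ₀ : ContinuousRep (GaloisGroupUnramifiedOutside K S) ℤ_[p] A)
  {M : Type} [AddCommGroup M] [DistribMulAction (absoluteGaloisGroup K) M] [TopologicalSpace M]
  [DiscreteTopology M]
  (ψ : A ≃+ M) (hψ : ∀ (σ : absoluteGaloisGroup K) (a : A), ψ (ρ₀ (toUnramifiedQuot K S σ) a) = σ • ψ a)

/-! ## §1 `loc_w[c] = [c']` on cocycles -/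

omit [IsTopologicalRing (PowerSeries ℤ_[p])] in
/-- **`loc_w[c] = [c']` iff `c ∘ (Γ_{K_w} → G_{K,S}) − c'` is a coboundary of `𝐃₁|_{Γ_{K_w}}`** (Mathlib
`map_oneCocycleClass` + `oneCocycleClass_eq_zero_iff`). [cite: Greenberg2016Selmer, §1 p. 3 L26–28]
[cite: SerreGaloisCohomology1997, I §2.3–2.4] -/
theorem loc_bigRep_oneCocycleClass_eq_iff (w : Place K)
    (c : contOneCocycles (bigRep (κ.liftUnramifiedOutside S hS) ρ₀).toTopRep)
    (c' : contOneCocycles (localRep S (bigRep (κ.liftUnramifiedOutside S hS) ρ₀) w).toTopRep) :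
    loc S (bigRep (κ.liftUnramifiedOutside S hS) ρ₀) w 1
        (oneCocycleClass (bigRep (κ.liftUnramifiedOutside S hS) ρ₀).toTopRep c) =
        oneCocycleClass _ c' ↔
      ∃ Φ : BigRepModule ℤ_[p] p A, ∀ τ : absoluteGaloisGroup w.Completion,
        c.1 (localToUnramified S w τ) - c'.1 τ =
          bigRep (κ.liftUnramifiedOutside S hS) ρ₀ (localToUnramified S w τ) Φ - Φ := by
  change (ContinuousCohomology.map (localToUnramified S w)
      (X := (bigRep (κ.liftUnramifiedOutside S hS) ρ₀).toTopRep)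
      (Y := (localRep S (bigRep (κ.liftUnramifiedOutside S hS) ρ₀) w).toTopRep)
      (TopRep.ofHom ⟨ContinuousLinearMap.id _ _, fun _ ↦ rfl⟩) 1).hom
      (oneCocycleClass (bigRep (κ.liftUnramifiedOutside S hS) ρ₀).toTopRep c) = oneCocycleClass _ c' ↔ _
  rw [map_oneCocycleClass, ← sub_eq_zero, ← oneCocycleClass_sub, oneCocycleClass_eq_zero_iff]
  rfl

/-! ## §2 Landing in `H¹_{𝓕_nr^{S₀}}(K_∞, M)` -/

include hψ in
/-- **THE DESCENT LANDS IN `H¹_{𝓕_nr^{S₀}}(K_∞, M)` when `loc_w[c] = 0` off `S₀`.** `S ⊇ {w ∣ p} = {v, v̄}`;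
if the continuous crossed homomorphism `c : G_{K,S} → 𝐃₁` has `loc_w[c] = 0` at every finite `w ∈ S` with
`w ≠ v` which is NOT in `S₀`, and at `v̄`, then `F[c]` is unramified at every place of `K_∞` above every
`w ∉ S₀ ∪ {p-places}` (`w ∉ S`: inertia dies in `G_{K,S}`; `w ∈ S`: locally trivial, file 4) and satisfies
Castella's conditions above `p` (relaxed at `v`; strict `M⁺ = 0` at `v̄` from `loc_v̄ = 0`). File 5's
`shapiroDescent_mem_unrSelmer_of_mem_fullAtSelmer` is the case `S₀ = ∅`.
[cite: Castella2018, §2.2 Def. 2.2 (p. 13)] [cite: GreenbergVatsal2000, §2 pp. 16–17, 20, 23]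
[cite: SkinnerUrban2014, §3.1.3 and Prop. 3.2.3] -/
theorem shapiroDescent_mem_unrSelmer_of_loc_eq_zero (hA : ∀ a : A, ∃ k : ℕ, p ^ k • a = 0)
    {F : (bigRep (κ.liftUnramifiedOutside S hS) ρ₀).H 1 →+ subgroupH1 κ.kerSubgroup M}
    (hF : ∀ (c : contOneCocycles (bigRep (κ.liftUnramifiedOutside S hS) ρ₀).toTopRep)
      (z : contOneCocycles (discreteTopRep κ.kerSubgroup M)),
      (∀ h : κ.kerSubgroup, z.1 h = ψ ((c.1 (toUnramifiedQuot K S h) : BigRepModule ℤ_[p] p A) 0)) →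
      F (oneCocycleClass _ c) = oneCocycleClass _ z)
    {v vbar : HeightOneSpectrum (𝓞 K)} (hv : ((p : ℕ) : 𝓞 K) ∈ v.asIdeal) (hne : vbar ≠ v)
    (hSp : ∀ w : HeightOneSpectrum (𝓞 K), ((p : ℕ) : 𝓞 K) ∈ w.asIdeal → w = v ∨ w = vbar)
    (S₀ : Set (HeightOneSpectrum (𝓞 K)))
    (c : contOneCocycles (bigRep (κ.liftUnramifiedOutside S hS) ρ₀).toTopRep)
    (hloc : ∀ w : HeightOneSpectrum (𝓞 K), w ∈ S → w ≠ v → w ∉ S₀ ∨ w = vbar →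
      loc S (bigRep (κ.liftUnramifiedOutside S hS) ρ₀) (Sum.inr w) 1 (oneCocycleClass _ c) = 0) :
    F (oneCocycleClass _ c) ∈ unrSelmer κ M vbar S₀ := by
  rw [unrSelmer, datumSelmerInfty_eq, mem_datumSelmer_iff, mem_unramifiedOutside_iff]
  refine ⟨fun w hwS₀ hpw σ ↦ ?_, fun w hpw σ ↦ ?_⟩
  · by_cases hwS : w ∈ S
    · have hwv : w ≠ v := fun h ↦ hpw (h ▸ hv)
      exact awayKer_le_unramifiedKer κ.kerSubgroup w
        (conjH1_shapiroDescent_mem_awayKer_of_loc_eq_zero S hS κ ρ₀ ψ hψ hA hF w c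
          (hloc w hwS hwv (Or.inl hwS₀)) σ)
    · exact conjH1_shapiroDescent_mem_unramifiedKer_of_not_mem S hS κ ρ₀ ψ hψ hF hwS c σ
  · rcases hSp w hpw with rfl | rfl
    · rw [Castella2018.AcSelmer.bdpData_of_ne (M := M) p vbar hpw hne.symm]
      refine (Castella2018.AcSelmer.relaxedDatum M w).strictKer_le_greenbergKer κ.kerSubgroup ?_
      rw [Castella2018.AcSelmer.strictKer_relaxedDatum_eq_top]
      trivial
    · rw [Castella2018.AcSelmer.bdpData_self (M := M) p w hpw]
      refine (Castella2018.AcSelmer.strictDatum M w).strictKer_le_greenbergKer κ.kerSubgroup ?_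
      rw [Literature.NumberTheory.EllipticCurves.BigGaloisRep.strictKer_strictDatum_eq_awayKer]
      exact conjH1_shapiroDescent_mem_awayKer_of_loc_eq_zero S hS κ ρ₀ ψ hψ hA hF w c
        (hloc w (hS w hpw) hne (Or.inr rfl)) σ

/-! ## §3 The local classes of the conjugates of the descent -/

omit [IsTopologicalRing (PowerSeries ℤ_[p])] in
include hψ in
/-- **`res_{ker κ ⊓ D_w}(conj_σ F[c])` IS THE EVALUATION CLASS AT `κ σ` OF THE LOCAL COCYCLE.** Let
`c : G_{K,S} → 𝐃₁` be a continuous crossed homomorphism, `w` a finite place, `c'` a continuous crossed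
homomorphism of `Γ_{K_w}` in `𝐃₁` with `loc_w[c] = [c']`, `σ ∈ Γ_K`, and `ζ` a cocycle of `ker κ ⊓ D_w` in `M`
with `ζ(x) = ψ(c'(τ)(κ σ))` whenever `τ ∈ Γ_{K_w}` restricts to `x`. Then
`res_{ker κ ⊓ D_w}(conj_σ F[c]) = [ζ]`: on cocycles `σ • ψ(c(σ̄⁻¹ x̄ σ̄)(0)) = ψ(c(x̄)(κσ)) + (x • b − b)`
(`rho_apply_conj_zero`) and `c(x̄)(κσ) − c'(τ)(κσ) = x • Φ(κσ) − Φ(κσ)` (`loc_w[c] = [c']`, `κ x = 1`). This is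
[SkinnerUrban2014] (3.1.2.a)–(3.1.2.b): the conjugates `σ = γ^i` of the chosen place are the places of `K_∞`
above `w`, read off at the evaluation points `i = κ(γ^i)`. [cite: SkinnerUrban2014, §3.1.2 ((3.1.2.a)–(3.1.2.b)) and Prop. 3.2.3]
[cite: SerreGaloisCohomology1997, I §2.5 and I §5.1] -/
theorem resOfLe_conjH1_shapiroDescent_eq
    {F : (bigRep (κ.liftUnramifiedOutside S hS) ρ₀).H 1 →+ subgroupH1 κ.kerSubgroup M}
    (hF : ∀ (c : contOneCocycles (bigRep (κ.liftUnramifiedOutside S hS) ρ₀).toTopRep)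
      (z : contOneCocycles (discreteTopRep κ.kerSubgroup M)),
      (∀ h : κ.kerSubgroup, z.1 h = ψ ((c.1 (toUnramifiedQuot K S h) : BigRepModule ℤ_[p] p A) 0)) →
      F (oneCocycleClass _ c) = oneCocycleClass _ z)
    (w : HeightOneSpectrum (𝓞 K)) (σ : absoluteGaloisGroup K)
    (c : contOneCocycles (bigRep (κ.liftUnramifiedOutside S hS) ρ₀).toTopRep)
    (c' : contOneCocycles
      (localRep S (bigRep (κ.liftUnramifiedOutside S hS) ρ₀) (Sum.inr w : Place K)).toTopRep)
    (hcc' : loc S (bigRep (κ.liftUnramifiedOutside S hS) ρ₀) (Sum.inr w) 1 (oneCocycleClass _ c) =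
      oneCocycleClass _ c')
    (ζ : contOneCocycles (discreteTopRep ↥(κ.kerSubgroup ⊓ decomp (K := K) w) M))
    (hζ : ∀ (x : ↥(κ.kerSubgroup ⊓ decomp (K := K) w)) (τ : absoluteGaloisGroup (w.adicCompletion K)),
      absGaloisRestrict K (w.adicCompletion K) τ = (x : absoluteGaloisGroup K) →
      ζ.1 x = ψ ((c'.1 τ : BigRepModule ℤ_[p] p A) (κ σ).toAdd)) :
    resOfLe M (inf_le_left : κ.kerSubgroup ⊓ decomp (K := K) w ≤ κ.kerSubgroup)
        (conjH1 κ.kerSubgroup M σ (F (oneCocycleClass _ c))) = oneCocycleClass _ ζ := by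
  obtain ⟨z, hz⟩ := exists_shapiroCocycle S hS κ ρ₀ ψ hψ c
  have hc : ∀ g h : GaloisGroupUnramifiedOutside K S, (c.1 (g * h) : BigRepModule ℤ_[p] p A) =
      c.1 g + bigRep (κ.liftUnramifiedOutside S hS) ρ₀ g (c.1 h) := fun g h ↦ c.2 g h
  obtain ⟨Φ, hΦ⟩ := (loc_bigRep_oneCocycleClass_eq_iff S hS κ ρ₀ (Sum.inr w) c c').1 hcc'
  rw [hF c z hz, ← sub_eq_zero, conjH1_oneCocycleClass_eq, resOfLe, resH1Hom_oneCocycleClass_eq',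
    ← oneCocycleClass_sub, oneCocycleClass_eq_zero_iff]
  refine ⟨ψ (Φ (κ σ).toAdd + (c.1 (toUnramifiedQuot K S σ) : BigRepModule ℤ_[p] p A) (κ σ).toAdd),
    fun x ↦ ?_⟩
  have hxH : κ.liftUnramifiedOutside S hS (toUnramifiedQuot K S (x : absoluteGaloisGroup K)) = 1 := by
    rw [ZpExtension.liftUnramifiedOutside_mk]
    exact ZpExtension.mem_kerSubgroup.1 (Subgroup.mem_inf.1 x.2).1
  obtain ⟨τ, hτ⟩ := (mem_decomp_iff w _).1 (Subgroup.mem_inf.1 x.2).2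
  have hτ' : localToUnramified S (Sum.inr w : Place K) τ = toUnramifiedQuot K S (x : absoluteGaloisGroup K) := by
    rw [← hτ]; rfl
  have key := BigRepModule.rho_apply_conj_zero (κ.liftUnramifiedOutside S hS) ρ₀ hc (toUnramifiedQuot K S σ) hxH
  rw [ZpExtension.liftUnramifiedOutside_mk] at key
  have hq : toUnramifiedQuot K S (σ⁻¹ * (x : absoluteGaloisGroup K) * σ) =
      (toUnramifiedQuot K S σ)⁻¹ * toUnramifiedQuot K S (x : absoluteGaloisGroup K) * toUnramifiedQuot K S σ := by
    rw [map_mul, map_mul, map_inv]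
  -- the principal part of `c|_{Γ_{K_w}} − c'` at `τ`, evaluated at `κ σ`
  have hΦτ := congrArg (fun Ψ : BigRepModule ℤ_[p] p A ↦ Ψ (κ σ).toAdd) (hΦ τ)
  simp only at hΦτ
  rw [BigRepModule.sub_apply, BigRepModule.sub_apply, bigRep_apply_apply, hτ', hxH, toAdd_one,
    sub_zero] at hΦτ
  change σ • z.1 (subgroupConj κ.kerSubgroup σ
      (subgroupInclusion (inf_le_left : κ.kerSubgroup ⊓ decomp (K := K) w ≤ κ.kerSubgroup) x)) - ζ.1 x =
    (x : absoluteGaloisGroup K) • (ψ (Φ (κ σ).toAdd + (c.1 (toUnramifiedQuot K S σ) : BigRepModule ℤ_[p] p A) (κ σ).toAdd))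
      - ψ (Φ (κ σ).toAdd + (c.1 (toUnramifiedQuot K S σ) : BigRepModule ℤ_[p] p A) (κ σ).toAdd)
  simp only [hz, subgroupConj_apply_coe, subgroupInclusion_apply_coe]
  rw [hζ x τ hτ, ← hψ, hq, key, ← hψ, ← map_sub ψ, ← map_sub ψ, map_add,
    sub_eq_iff_eq_add.1 hΦτ]
  congr 1
  abel

/-! ## §4 `H¹_{𝓕_nr}(K_∞, M)` dies in `H¹(ker κ ⊓ D_w, M)` at every place above `w ∈ S_f` -/

omit [TopologicalSpace (PowerSeries ℤ_[p])] [IsTopologicalRing (PowerSeries ℤ_[p])] in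
/-- **Classes of `H¹_{𝓕_nr}(K_∞, M)` are locally trivial at every place of `K_∞` above a finitely
decomposed `w ∤ p`.** For `u ∈ H¹_{𝓕_nr}` (`S₀ = ∅`), `w ∤ p` with `D_w ⊄ ker κ`, and every `σ ∈ Γ_K`:
`res_{ker κ ⊓ D_w}(conj_σ u) = 0` — unramified (definition of `𝓕_nr`) ⇒ locally trivial
(`unramifiedKer_le_awayKer_of_not_decomp_le`; `I_w ≤ ker κ` since `w ∤ p`). [cite: GreenbergVatsal2000, §2 p. 17]
[cite: KellerYin2024, Rem. 1.2.3 (i) (arXiv:2402.12781v2 TeX L685–690)] -/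
theorem resOfLe_conjH1_eq_zero_of_mem_unrSelmer_empty
    (hstab : ∀ m : M, IsOpen (MulAction.stabilizer (absoluteGaloisGroup K) m : Set (absoluteGaloisGroup K)))
    (hM : ∀ m : M, ∃ k : ℕ, p ^ k • m = 0) (vbar : HeightOneSpectrum (𝓞 K))
    {w : HeightOneSpectrum (𝓞 K)} (hpw : ((p : ℕ) : 𝓞 K) ∉ w.asIdeal)
    (hD : ¬ decomp (K := K) w ≤ κ.kerSubgroup) {u : subgroupH1 κ.kerSubgroup M}
    (hu : u ∈ unrSelmer κ M vbar (∅ : Set (HeightOneSpectrum (𝓞 K)))) (σ : absoluteGaloisGroup K) :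
    resOfLe M (inf_le_left : κ.kerSubgroup ⊓ decomp (K := K) w ≤ κ.kerSubgroup)
      (conjH1 κ.kerSubgroup M σ u) = 0 := by
  rw [unrSelmer, datumSelmerInfty_eq, mem_datumSelmer_iff, mem_unramifiedOutside_iff] at hu
  exact UnramifiedLeAwayKer.unramifiedKer_le_awayKer_of_not_decomp_le κ hstab hM
    (IwasawaTwoVariable.inertia_le_kerSubgroup_of_not_mem κ hpw) hD (hu.1 w (Set.notMem_empty w) hpw σ)

end LocalClasses

end Summit.BirchSwinnertonDyer.BirchSwinnertonDyer.Theorems.AcTwistDeformation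

end
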